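import Summits.HubbardSuperconductivity.HubbardSuperconductivity.Theorems.ThermalWedgeTwSeededEnsembleEquivalenceSeedCommutator
import Literature.MathematicalPhysics.QuantumLattice.HubbardCommutatorBound

/-!
# Crux `TwSeededEnsembleEquivalence` (stmt-HubbardSuperconductivity-1698), line `exposed-density-duality`
# (thermal member) — stub `stub_commutatorSums` (STUB C)

Commutator sums of the seeded grand-canonical torus Hamiltonian
`K_L(0) = hubbardTorusWith 2 L 1 U 0 − (g/L²) P_L`, `P_L = (pairField d L)ᴴ (pairField d L)`, with the
one-orbital fermion operators: both `‖Σ_o c_o† [K_L(0), c_o]‖` and `‖Σ_o c_o [K_L(0), c_o†]‖` are at most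
`(18(2 + |U|) + g C) · 2L²`, where `C ≥ 0` is the absolute constant of the landed seed commutator bound
`stub_seedCommutator` (`‖[P_L, c_o^{(†)}]‖ ≤ C L²`).

Proof: triangle inequality over the `2L² = |Orb (FermionTorus 2 L)|` orbitals, `‖c_o‖, ‖c_o†‖ ≤ 1`
(`norm_annihilation_le_one`, `norm_creation_le_one`), and per orbital
`‖[K_L(0), c]‖ ≤ ‖[H(1,U) − 0·N, c]‖ + (g/L²) ‖[P_L, c]‖ ≤ 18(2 + |U| + 2|0|) + (g/L²) · C L²`
(tree `norm_commutator_hubbardTorusWith_{annihilation,creation}_le` at `μ = 0`).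

Technical point (as in `…SeedCommutator.lean` and `HubbardCommutatorBound.lean`): the `L²`-operator norm
on the torus depends syntactically on the `DecidableEq (FermionTorus 2 L)` instance; the concrete statements
(`stub_seedCommutator`, `norm_commutator_hubbardTorusWith_*`, the present one) carry the instance found on the
concrete type, the generic one-orbital norm bounds carry `LinearOrder.toDecidableEq`. The two abstract
helpers below are therefore stated for an arbitrary `[DecidableEq n]`, and the one-orbital bounds are
transported by `convert` (the instances agree by `Subsingleton.elim`).
-/

set_option linter.dupNamespace false

namespace Summit.HubbardSuperconductivity.HubbardSuperconductivity.Theorems.TwSeededEnsembleEquivalence.ThermalDuality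

open Matrix Finset Literature.MathematicalPhysics.QuantumLattice
open Summit.HubbardSuperconductivity.HubbardSuperconductivity.Theorems.TwSeededEnsembleEquivalence.ExposedDensity
open scoped ComplexOrder Matrix.Norms.L2Operator

noncomputable section

section CommutatorSumHelpers

variable {n : Type*} [Fintype n] [DecidableEq n]

/-- Triangle inequality for a sum of products `Σ_o a_o X_o` with `‖a_o‖ ≤ 1` and `‖X_o‖ ≤ B`
(`L²`-operator norm): `‖Σ_o a_o X_o‖ ≤ B · |κ|`. [folklore] -/
private theorem cs_norm_sum_mul_le {κ : Type*} [Fintype κ] (a X : κ → Matrix n n ℂ) {B : ℝ}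
    (ha : ∀ o, ‖a o‖ ≤ 1) (hX : ∀ o, ‖X o‖ ≤ B) :
    ‖∑ o, a o * X o‖ ≤ B * Fintype.card κ := by
  calc ‖∑ o, a o * X o‖ ≤ ∑ o, ‖a o * X o‖ := norm_sum_le _ _
    _ ≤ ∑ _o : κ, B := Finset.sum_le_sum fun o _ => by
        calc ‖a o * X o‖ ≤ ‖a o‖ * ‖X o‖ := norm_mul_le _ _
          _ ≤ 1 * B := mul_le_mul (ha o) (hX o) (norm_nonneg _) zero_le_one
          _ = B := one_mul B
    _ = B * Fintype.card κ := by
        rw [Finset.sum_const, Finset.card_univ, nsmul_eq_mul, mul_comm]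

/-- The commutator of a perturbed operator `H − r P` (`r ≥ 0` real) with `c` is bounded by
`‖[H, c]‖ + r ‖[P, c]‖` (`L²`-operator norm). [folklore] -/
private theorem cs_norm_commutator_sub_smul_le (H P c : Matrix n n ℂ) {r h p : ℝ} (hr : 0 ≤ r)
    (hH : ‖H * c - c * H‖ ≤ h) (hP : ‖P * c - c * P‖ ≤ p) :
    ‖(H - (r : ℂ) • P) * c - c * (H - (r : ℂ) • P)‖ ≤ h + r * p := by
  have hid : (H - (r : ℂ) • P) * c - c * (H - (r : ℂ) • P) =
      (H * c - c * H) - (r : ℂ) • (P * c - c * P) := by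
    simp only [Matrix.sub_mul, Matrix.mul_sub, Matrix.smul_mul, Matrix.mul_smul, smul_sub]
    abel
  rw [hid]
  calc ‖(H * c - c * H) - (r : ℂ) • (P * c - c * P)‖
      ≤ ‖H * c - c * H‖ + ‖(r : ℂ) • (P * c - c * P)‖ := norm_sub_le _ _
    _ = ‖H * c - c * H‖ + r * ‖P * c - c * P‖ := by
        rw [norm_smul, Complex.norm_real, Real.norm_of_nonneg hr]
    _ ≤ h + r * p := add_le_add hH (mul_le_mul_of_nonneg_left hP hr)

end CommutatorSumHelpers

/-- `‖c_o‖ ≤ 1` on the torus, for the `DecidableEq` instance found on the concrete type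
(tree `norm_annihilation_le_one`, transported along `Subsingleton.elim`). [folklore] -/
private theorem cs_norm_annihilation_le_one (L : ℕ) (o : Orb (FermionTorus 2 L)) :
    ‖annihilation o‖ ≤ 1 := by
  convert norm_annihilation_le_one o

/-- `‖c†_o‖ ≤ 1` on the torus, for the `DecidableEq` instance found on the concrete type
(tree `norm_creation_le_one`, transported along `Subsingleton.elim`). [folklore] -/
private theorem cs_norm_creation_le_one (L : ℕ) (o : Orb (FermionTorus 2 L)) :
    ‖creation o‖ ≤ 1 := by
  convert norm_creation_le_one o

/-- `|Orb (FermionTorus 2 L)| = 2L²` (as a real number). [folklore] -/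
private theorem cs_card_orb_fermionTorus_two (L : ℕ) :
    (Fintype.card (Orb (FermionTorus 2 L)) : ℝ) = 2 * (L : ℝ) ^ 2 := by
  have h : Fintype.card (Orb (FermionTorus 2 L)) = 2 * L ^ 2 := by
    simp [FermionTorus, Fintype.card_lex, Fintype.card_prod, mul_comm]
  rw [h]
  push_cast
  ring

/-- STUB C — COMMUTATOR SUMS of the seeded torus Hamiltonian `K_L(0) = hubbardTorusWith 2 L 1 U 0 − (g/L²)P_L` with the
one-orbital operators: `‖Σ_o c_o† [K_L(0), c_o]‖` and `‖Σ_o c_o [K_L(0), c_o†]‖` are at most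
`(18(2 + |U|) + g C)·2L²` (`2L²` orbitals, `‖c_o‖, ‖c_o†‖ ≤ 1`, tree
`norm_commutator_hubbardTorusWith_{annihilation,creation}_le` at `μ = 0`, landed `stub_seedCommutator` for the seed with
its absolute constant `C`). [folklore] -/
theorem stub_commutatorSums :
    ∃ C : ℝ, 0 ≤ C ∧ ∀ (L : ℕ) [NeZero L] (U g : ℝ), 0 ≤ g →
      ‖∑ o : Orb (FermionTorus 2 L), creation o *
          ((hubbardTorusWith 2 L 1 U 0 - ((g / (L : ℝ) ^ 2 : ℝ) : ℂ) •
              ((pairField dWaveFormFactor L)ᴴ * pairField dWaveFormFactor L)) * annihilation o -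
            annihilation o * (hubbardTorusWith 2 L 1 U 0 - ((g / (L : ℝ) ^ 2 : ℝ) : ℂ) •
              ((pairField dWaveFormFactor L)ᴴ * pairField dWaveFormFactor L)))‖ ≤
        (18 * (2 + |U|) + g * C) * (2 * (L : ℝ) ^ 2) ∧
      ‖∑ o : Orb (FermionTorus 2 L), annihilation o *
          ((hubbardTorusWith 2 L 1 U 0 - ((g / (L : ℝ) ^ 2 : ℝ) : ℂ) •
              ((pairField dWaveFormFactor L)ᴴ * pairField dWaveFormFactor L)) * creation o -
            creation o * (hubbardTorusWith 2 L 1 U 0 - ((g / (L : ℝ) ^ 2 : ℝ) : ℂ) •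
              ((pairField dWaveFormFactor L)ᴴ * pairField dWaveFormFactor L)))‖ ≤
        (18 * (2 + |U|) + g * C) * (2 * (L : ℝ) ^ 2) := by
  obtain ⟨C, hC0, hC⟩ := stub_seedCommutator
  refine ⟨C, hC0, fun L _ U g hg => ?_⟩
  have hL : (0 : ℝ) < (L : ℝ) ^ 2 := by
    have : (0 : ℝ) < (L : ℝ) := by exact_mod_cast Nat.pos_of_ne_zero (NeZero.ne L)
    positivity
  have hr : 0 ≤ g / (L : ℝ) ^ 2 := div_nonneg hg hL.le
  have hgC : 18 * (2 + |U| + 2 * |(0 : ℝ)|) + g / (L : ℝ) ^ 2 * (C * (L : ℝ) ^ 2) =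
      18 * (2 + |U|) + g * C := by
    rw [abs_zero, mul_zero, add_zero, div_mul_eq_mul_div, mul_div_assoc, mul_div_assoc,
      div_self hL.ne', mul_one]
  -- per-orbital bounds
  have h1 : ∀ o : Orb (FermionTorus 2 L),
      ‖(hubbardTorusWith 2 L 1 U 0 - ((g / (L : ℝ) ^ 2 : ℝ) : ℂ) •
            ((pairField dWaveFormFactor L)ᴴ * pairField dWaveFormFactor L)) * annihilation o -
          annihilation o * (hubbardTorusWith 2 L 1 U 0 - ((g / (L : ℝ) ^ 2 : ℝ) : ℂ) •
            ((pairField dWaveFormFactor L)ᴴ * pairField dWaveFormFactor L))‖ ≤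
        18 * (2 + |U|) + g * C := fun o => by
    have ho : orb (ofLex o).1 (ofLex o).2 = o := rfl
    have hH := norm_commutator_hubbardTorusWith_annihilation_le U 0 L (ofLex o).1 (ofLex o).2
    rw [ho] at hH
    exact (cs_norm_commutator_sub_smul_le _ _ _ hr hH (hC L o).1).trans hgC.le
  have h2 : ∀ o : Orb (FermionTorus 2 L),
      ‖(hubbardTorusWith 2 L 1 U 0 - ((g / (L : ℝ) ^ 2 : ℝ) : ℂ) •
            ((pairField dWaveFormFactor L)ᴴ * pairField dWaveFormFactor L)) * creation o -
          creation o * (hubbardTorusWith 2 L 1 U 0 - ((g / (L : ℝ) ^ 2 : ℝ) : ℂ) •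
            ((pairField dWaveFormFactor L)ᴴ * pairField dWaveFormFactor L))‖ ≤
        18 * (2 + |U|) + g * C := fun o => by
    have ho : orb (ofLex o).1 (ofLex o).2 = o := rfl
    have hH := norm_commutator_hubbardTorusWith_creation_le U 0 L (ofLex o).1 (ofLex o).2
    rw [ho] at hH
    exact (cs_norm_commutator_sub_smul_le _ _ _ hr hH (hC L o).2).trans hgC.le
  refine ⟨?_, ?_⟩
  · calc _ ≤ (18 * (2 + |U|) + g * C) * Fintype.card (Orb (FermionTorus 2 L)) :=
          cs_norm_sum_mul_le (fun o => creation o) _ (cs_norm_creation_le_one L) h1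
      _ = (18 * (2 + |U|) + g * C) * (2 * (L : ℝ) ^ 2) := by rw [cs_card_orb_fermionTorus_two]
  · calc _ ≤ (18 * (2 + |U|) + g * C) * Fintype.card (Orb (FermionTorus 2 L)) :=
          cs_norm_sum_mul_le (fun o => annihilation o) _ (cs_norm_annihilation_le_one L) h2
      _ = (18 * (2 + |U|) + g * C) * (2 * (L : ℝ) ^ 2) := by rw [cs_card_orb_fermionTorus_two]

end

end Summit.HubbardSuperconductivity.HubbardSuperconductivity.Theorems.TwSeededEnsembleEquivalence.ThermalDuality
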